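import Summits.HodgeConjecture.HodgeConjecture.Theorems.K2E3CayleyCharpolyDiscr   -- ★ (this seat): `det_smul_one_sub_smul_eq_prod`, `prod_prod_Ioi_mul_eq_pow`, `exists_eq_prod_X_sub_C_of_splits`, `map_discr_charpoly`
import HarnessLib

/-!
# K2 · E3 ∕ U12-d kit — the discriminant of the characteristic polynomial under scalars, GENERAL rank: `disc(χ_{z·A}) = z^{N(N−1)} · disc(χ_A)`,
# and the CENTRAL-TRANSLATION INVARIANCE of the socket's unit relation `u·det(g)^{N−1} = disc(χ_g)`

HCML Track B «K2-LIT», cell `pub/hodgecm-mathlib`, crux H413 = `stmt-HodgeConjecture-24833` (`--supports … --as helper`), seat `hodgecm-mathlib-K2E3-p12` (g0), socket #12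
`sig_K2E3NormalizedCharBddNearSemisimple` (sub-line «HC descent at a semisimple point», dealer K2E3-plan (g1) BATCHES #1–#2).  The weight `√√‖u‖ = |D_G(g)|^{1∕2}` of ★
`normalizedCharacter_locallyBounded` ∕ socket #12 is attached to the unit `u` with `u·det(g)^{N−1} = disc(χ_g)`; this file shows that the relation — hence the weight — is
INVARIANT UNDER CENTRAL (scalar) TRANSLATION `g ↦ z·g` (`z` a unit scalar): `D_G(zg) = D_G(g)`, as it must be since `Ad(zg) = Ad(g)`.  With ★ `unit_mul_det_pow_eq_of_cayley`
this reads the weight along the Cayley slice `z·c(Y)` through a CENTRAL point `z·1` as `‖2^{N(N−1)} disc(χ_Y)‖ · ‖det(1 − Y²)‖^{−(N−1)}` — the group-to-Lie-algebra comparison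
[HarishChandra1999 §17 «`|η_𝔤(X)| = |D_G(exp X)|`»] at central points, in the socket's currency, for every `N`.  The tree had the scalar law at `N = 3` only (★
`Literature.LinearAlgebra.Matrix.discr_smul_fin_three`: `discr(t • Y) = t⁶ · discr Y`).
* §1 over an algebraically closed field: `charpoly_smul_eq_prod` (`χ_{z·A} = Π (T − zξ_i)`), `discr_charpoly_smul_of_isAlgClosed`.
* §2 any commutative ring (universal matrix-and-scalar over `ℤ[X_ij, z]`, a domain, embedded in an algebraic closure; naturality ★ `map_discr_charpoly`):
  **`discr_charpoly_smul`**: `disc(χ_{z·A}) = z^{N(N−1)}·disc(χ_A)`.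
* §3 **`unitRel_smul_iff`**: for a unit scalar `z`, `u·det(z·A)^{N−1} = disc(χ_{z·A}) ↔ u·det(A)^{N−1} = disc(χ_A)`; and the Cayley-slice reading at a central point
  **`unit_mul_det_pow_eq_of_smul_cayley`**: `u·det(z·c(Y))^{N−1} = disc(χ_{z·c(Y)}) → u·(det(1−Y)·det(1+Y))^{N−1} = 2^{N(N−1)}·disc(χ_Y)`.
THEOREMS ONLY (no `def`, no instance, no notation, no `sorry`, axioms ⊆ the trio).  HONEST LABEL: pure algebra; HC_CM is proved only modulo the 7 printed citations
(2 remaining named inputs: hLiu418 = stmt-HodgeConjecture-24832, h413 = stmt-HodgeConjecture-24833) until rung 0 closes.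

## References
* [BasuPollackRoy2006] S. Basu, R. Pollack, M.-F. Roy, *Algorithms in Real Algebraic Geometry*, 2nd ed. (2006), Ch. 4 §4.1 (discriminant `Π_{i<j}(x_i − x_j)²`, homogeneity).
* [HarishChandra1999AdmissibleDistributions] Harish-Chandra (DeBacker–Sally), *Admissible Invariant Distributions on Reductive p-adic Groups* (1999), §17 (`D_G`).
* [Rogawski1990] J. D. Rogawski, *Automorphic Representations of Unitary Groups in Three Variables* (1990), §4.9 p. 54 (`D_G(γ) = |Π(1 − α(γ))|^{1∕2}`, central characters).
-/

set_option autoImplicit false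
set_option linter.dupNamespace false

open Polynomial Finset

namespace Summit.HodgeConjecture.HodgeConjecture.Cruxes.H413.K2E3CharpolyDiscrSmul

open Summit.HodgeConjecture.HodgeConjecture.Cruxes.H413.K2E3CayleyCharpolyDiscrField
open Summit.HodgeConjecture.HodgeConjecture.Cruxes.H413.K2E3CayleyCharpolyDiscr

/-! ## §1 Over an algebraically closed field -/

section Field

variable {L : Type*} [Field L] {N : ℕ}

/-- `χ_{z·A} = Π (T − z·ξ_i)` when `χ_A = Π (T − ξ_i)` (values at every `t`: ★ `det_smul_one_sub_smul_eq_prod` with `a = t`, `b = z`). [cite: BasuPollackRoy2006, Ch. 4 §4.1] -/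
theorem charpoly_smul_eq_prod [Infinite L] (A : Matrix (Fin N) (Fin N) L) (ξ : Fin N → L) (hξ : A.charpoly = ∏ i, (X - C (ξ i))) (z : L) :
    (z • A).charpoly = ∏ i, (X - C (z * ξ i)) := by
  apply Polynomial.funext
  intro t
  rw [Matrix.eval_charpoly, Matrix.scalar_apply, ← Matrix.smul_one_eq_diagonal, det_smul_one_sub_smul_eq_prod A ξ hξ t z, Polynomial.eval_prod]
  exact Finset.prod_congr rfl fun i _ => by rw [eval_sub, eval_X, eval_C]

/-- `disc(χ_{z·A}) = z^{N(N−1)} · disc(χ_A)` over an algebraically closed field (roots scale by `z`; `Π_{i<j} z·z = (z^N)^{N−1}`). [cite: BasuPollackRoy2006, Ch. 4 §4.1] -/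
theorem discr_charpoly_smul_of_isAlgClosed [IsAlgClosed L] (A : Matrix (Fin N) (Fin N) L) (z : L) :
    (z • A).charpoly.discr = z ^ (N * (N - 1)) * A.charpoly.discr := by
  haveI : Infinite L := IsAlgClosed.instInfinite
  obtain ⟨ξ, hξ⟩ := exists_eq_prod_X_sub_C_of_splits (IsAlgClosed.splits A.charpoly) (Matrix.charpoly_monic A)
    (by rw [Matrix.charpoly_natDegree_eq_dim, Fintype.card_fin])
  rw [charpoly_smul_eq_prod A ξ hξ z, hξ,
    Literature.Algebra.Polynomial.DiscriminantRootProduct.discr_prod_X_sub_C_eq_prod_prod_Ioi_sq,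
    Literature.Algebra.Polynomial.DiscriminantRootProduct.discr_prod_X_sub_C_eq_prod_prod_Ioi_sq]
  have hz : z ^ (N * (N - 1)) = ∏ i : Fin N, ∏ j ∈ Ioi i, (z * z) := by
    rw [prod_prod_Ioi_mul_eq_pow, Finset.prod_const, Finset.card_univ, Fintype.card_fin, ← pow_mul]
  rw [hz, ← Finset.prod_mul_distrib]
  refine Finset.prod_congr rfl fun i _ => ?_
  rw [← Finset.prod_mul_distrib]
  refine Finset.prod_congr rfl fun j _ => ?_
  ring

end Field

/-! ## §2 Over any commutative ring (universal matrix and scalar) -/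

section AnyRing

variable {R : Type*} [CommRing R] {N : ℕ}

/-- A ring map commutes with scalar multiplication of matrices: `(r·A).map φ = φ(r)·A.map φ`. [folklore] -/
theorem map_smul_ringHom {B B' : Type*} [CommRing B] [CommRing B'] (φ : B →+* B') (r : B) (A : Matrix (Fin N) (Fin N) B) :
    (r • A).map φ = φ r • A.map φ := by
  ext i j
  simp only [Matrix.map_apply, Matrix.smul_apply, smul_eq_mul, map_mul]

/-- **`disc(χ_{z·A}) = z^{N(N−1)} · disc(χ_A)`** for every commutative ring `R`, `A ∈ M_N(R)`, `z ∈ R` (universal matrix-and-scalar over the domain `ℤ[X_ij, z]`, embedded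
in an algebraic closure of its fraction field where §1 applies; both sides are natural under ring maps, ★ `map_discr_charpoly`).  The rank-3 case is ★ `discr_smul_fin_three`.
[cite: BasuPollackRoy2006, Ch. 4 §4.1] -/
theorem discr_charpoly_smul (A : Matrix (Fin N) (Fin N) R) (z : R) :
    (z • A).charpoly.discr = z ^ (N * (N - 1)) * A.charpoly.discr := by
  -- universal objects: variables `some (i, j)` for the entries, `none` for the scalar
  set XU : Matrix (Fin N) (Fin N) (MvPolynomial (Option (Fin N × Fin N)) ℤ) := Matrix.of fun i j => MvPolynomial.X (some (i, j)) with hXU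
  set zU : MvPolynomial (Option (Fin N × Fin N)) ℤ := MvPolynomial.X none with hzU
  -- the universal identity, through an algebraic closure of `Frac S`
  set L := AlgebraicClosure (FractionRing (MvPolynomial (Option (Fin N × Fin N)) ℤ)) with hL
  set ι : MvPolynomial (Option (Fin N × Fin N)) ℤ →+* L :=
    (algebraMap (FractionRing (MvPolynomial (Option (Fin N × Fin N)) ℤ)) L).comp
      (algebraMap (MvPolynomial (Option (Fin N × Fin N)) ℤ) (FractionRing (MvPolynomial (Option (Fin N × Fin N)) ℤ))) with hι
  have hιinj : Function.Injective ι :=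
    (algebraMap (FractionRing (MvPolynomial (Option (Fin N × Fin N)) ℤ)) L).injective.comp
      (IsFractionRing.injective (MvPolynomial (Option (Fin N × Fin N)) ℤ) (FractionRing (MvPolynomial (Option (Fin N × Fin N)) ℤ)))
  have huniv : (zU • XU).charpoly.discr = zU ^ (N * (N - 1)) * XU.charpoly.discr := by
    apply hιinj
    rw [map_discr_charpoly ι, map_smul_ringHom, map_mul, map_pow, map_discr_charpoly ι]
    exact discr_charpoly_smul_of_isAlgClosed (XU.map ι) (ι zU)
  -- specialise `X_ij ↦ A_ij`, `z ↦ z`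
  set e : MvPolynomial (Option (Fin N × Fin N)) ℤ →+* R := MvPolynomial.eval₂Hom (Int.castRingHom R) (fun o => Option.elim o z fun p => A p.1 p.2) with he
  have heX : XU.map e = A := by
    ext i j
    simp only [hXU, he, Matrix.map_apply, Matrix.of_apply, MvPolynomial.eval₂Hom_X', Option.elim_some]
  have hez : e zU = z := by
    simp only [hzU, he, MvPolynomial.eval₂Hom_X', Option.elim_none]
  have h := congrArg e huniv
  rw [map_discr_charpoly e, map_smul_ringHom, map_mul, map_pow, map_discr_charpoly e, heX, hez] at h
  exact h

/-! ## §3 The socket's unit relation is invariant under central (scalar) translation -/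

/-- **`u·det(z·A)^{N−1} = disc(χ_{z·A}) ↔ u·det(A)^{N−1} = disc(χ_A)`** for a unit scalar `z` (`det(z·A)^{N−1} = z^{N(N−1)}·det(A)^{N−1}` and §2; cancel the unit `z^{N(N−1)}`):
the weight `|D_G|^{1∕2}` of ★ `normalizedCharacter_locallyBounded` ∕ socket #12 does not see the centre. [cite: HarishChandra1999AdmissibleDistributions, §17] [cite: Rogawski1990, §4.9 p. 54] -/
theorem unitRel_smul_iff (A : Matrix (Fin N) (Fin N) R) (z : Rˣ) (u : R) :
    u * ((z : R) • A).det ^ (N - 1) = ((z : R) • A).charpoly.discr ↔ u * A.det ^ (N - 1) = A.charpoly.discr := by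
  rw [discr_charpoly_smul, Matrix.det_smul, Fintype.card_fin, mul_pow, ← pow_mul, mul_left_comm]
  exact (Units.isUnit (z ^ (N * (N - 1)))).mul_right_inj.trans Iff.rfl |>.symm.trans (by rw [Units.val_pow_eq_pow_val]) |>.symm

/-- **Cayley-slice reading of the weight at a CENTRAL point**: if `u·det(z·c(Y))^{N−1} = disc(χ_{z·c(Y)})` for a unit scalar `z`, `c(Y) = (1+Y)(1−Y)⁻¹` with `det(1 − Y)` a
unit, then `u·(det(1−Y)·det(1+Y))^{N−1} = 2^{N(N−1)}·disc(χ_Y)` (§3 + ★ `unit_mul_det_pow_eq_of_cayley`).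
[cite: HarishChandra1999AdmissibleDistributions, §17] [cite: Rogawski1990, §4.9 p. 54] -/
theorem unit_mul_det_pow_eq_of_smul_cayley (Y : Matrix (Fin N) (Fin N) R) (h : IsUnit (1 - Y).det) (z : Rˣ) (u : R)
    (hu : u * ((z : R) • ((1 + Y) * (1 - Y)⁻¹)).det ^ (N - 1) = ((z : R) • ((1 + Y) * (1 - Y)⁻¹)).charpoly.discr) :
    u * ((1 - Y).det * (1 + Y).det) ^ (N - 1) = 2 ^ (N * (N - 1)) * Y.charpoly.discr :=
  unit_mul_det_pow_eq_of_cayley Y h u ((unitRel_smul_iff _ z u).1 hu)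

end AnyRing

end Summit.HodgeConjecture.HodgeConjecture.Cruxes.H413.K2E3CharpolyDiscrSmul
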